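import Summits.Ventures.PercRepro.CoreRegimesLow

/-!
# PercRepro — THEOREM R3 on the exact range `9 ≤ p ≤ 62`: the regime-A cells by kernel evaluation (p2, gen 11)

`CoreRegimesLow.lean` proves the regime A / B′ inequalities of night-1's `q = 3` counting route for every `p ≥ 63`,
`d ≥ 6`. Below `p = 63` the margins are too thin for the analytic constants (at `(13, 6)` the inequality holds by
`1.9 %`), and night-1 §13.3 verified the cells by exact arithmetic (three implementations: night-1's, p2's
`regimes_all.py`, ref-2's `r3check.py`). This file makes those cells KERNEL: regime A at `(p, d)` is equivalent to a
single inequality between natural numbers once `Φ(p,3)·C(p+3,3) = 2^{p+3} − 2·Σ_{u≤3} C(p+3,u)` (symmetry of the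
binomial row) is used — `cellOK p d` evaluates it with binomials computed as `descFactorial / factorial` — and the
kernel evaluates every cell `9 ≤ p ≤ 62`, `amin(p) ≤ d ≤ 3p + 2` (`amin = 8, 7, 7, 7, 6, 6, …`; ≈ 5,600 cells) by
`decide +kernel`; regime B′ on `d ≥ 3p − 1` is analytic as before, with the exact `C(p+3,3)` and the absorption
constants of `n ≥ 35` (`141/35`, `162/35`) and the finite numeric check `141·2^{p+3} + 162·C(p+3,3) ≤ 35·3^{p−4}·C(p+3,3)`
for `9 ≤ p ≤ 62`.

* `chooseF`, `chooseF_eq` — the fast binomial; `cellOK` — the cell predicate; `sum_Ioo_choose_add`,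
  `phiK_three_mul_choose_eq` — the closed form of `Φ(p,3)·C(p+3,3)`; **`regimeA_of_cellOK`** — `cellOK p d = true → RegimeA p d`;
* `table_9_12`, `table_13_30`, `table_30_39`, `table_39_47`, `table_47_55`, `table_55_63` — the cells, by `decide +kernel`
  (≤ 1,400 cells per theorem);
* `choose_three_ge_five_sq` (`n ≥ 33`), `lhsU_le_small` (`n ≥ 35`), `bprime_numeric` (`9 ≤ p ≤ 62`), **`regimeB_small`**;
* **`regime_small`** — `RegimeA p d ∨ RegimeB p d` for `9 ≤ p ≤ 62`, `amin p ≤ d`; **`regime_of_six_le_all`** — for every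
  `p ≥ 13`, `d ≥ 6` (`CoreRegimesLow` beyond `p = 62`); **`regime_of_amin`** — for every `p ≥ 9`, `amin p ≤ d`.
Imports `CoreRegimesLow` only. Axioms: standard (the kernel evaluations use no `native_decide`).
-/

namespace PercRepro
namespace CoreRegimes

open Finset

/-! ### The cell predicate -/

/-- The binomial coefficient as `descFactorial / factorial` (kernel-evaluable in `O(k)` multiplications). -/
def chooseF (n k : ℕ) : ℕ := n.descFactorial k / k.factorial

/-- `chooseF = Nat.choose`. -/
theorem chooseF_eq (n k : ℕ) : chooseF n k = Nat.choose n k := by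
  unfold chooseF
  rw [Nat.choose_eq_descFactorial_div_factorial]

/-- The regime-A cell at `(p, d)` as one inequality in `ℕ`:
`phiNum·(134·C(n,3) + 35·n²) + C(p+3,3)·(35·Σ_{j≤3} C(n,j) + 99·C(n,3) + 35·n² + 35·Σ_{j≤d} C(n,j)) ≤ C(p+3,3)·35·2ⁿ`
with `phiNum = 2^{p+3} − 2·Σ_{u≤3} C(p+3,u) = Φ(p,3)·C(p+3,3)`. -/
def cellOK (p d : ℕ) : Bool :=
  let n := p + d
  let phiNum := 2 ^ (p + 3) - 2 * ∑ u ∈ range 4, chooseF (p + 3) u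
  let phiDen := chooseF (p + 3) 3
  let c3 := chooseF n 3
  let tail := ∑ j ∈ range (d + 1), chooseF n j
  decide (phiNum * (134 * c3 + 35 * n ^ 2)
    + phiDen * (35 * ∑ j ∈ range 4, chooseF n j + 99 * c3 + 35 * n ^ 2 + 35 * tail) ≤ phiDen * 35 * 2 ^ n)

/-! ### The closed form of `Φ(p,3)·C(p+3,3)` -/

/-- `Σ_{3<u<p} C(p+3,u) + 2·Σ_{u<4} C(p+3,u) = 2^{p+3}` for `p ≥ 4` (the two ends of the binomial row are mirror images). -/
theorem sum_Ioo_choose_add (p : ℕ) (hp : 4 ≤ p) :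
    (∑ u ∈ Ioo 3 p, Nat.choose (p + 3) u) + 2 * ∑ u ∈ range 4, Nat.choose (p + 3) u = 2 ^ (p + 3) := by
  have hIoo : Ioo 3 p = Ico 4 p := by
    ext u; simp only [mem_Ioo, mem_Ico]; omega
  have h1 := sum_range_add_sum_Ico (fun u => Nat.choose (p + 3) u) (show 4 ≤ p + 3 + 1 by omega)
  rw [Nat.sum_range_choose] at h1
  have h2 := Finset.sum_Ico_consecutive (fun u => Nat.choose (p + 3) u) (show 4 ≤ p by omega) (show p ≤ p + 3 + 1 by omega)
  -- the top end reflects onto the bottom end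
  have h3 : ∑ u ∈ Ico p (p + 3 + 1), Nat.choose (p + 3) u = ∑ u ∈ range 4, Nat.choose (p + 3) u := by
    have h3a : ∑ u ∈ Ico p (p + 3 + 1), Nat.choose (p + 3) u
        = ∑ u ∈ Ico p (p + 3 + 1), Nat.choose (p + 3) (p + 3 - u) := by
      apply sum_congr rfl
      intro u hu
      simp only [mem_Ico] at hu
      exact (Nat.choose_symm (by omega)).symm
    rw [h3a, sum_Ico_reflect (fun j => Nat.choose (p + 3) j) p (le_refl (p + 3 + 1))]
    have e1 : p + 3 + 1 - (p + 3 + 1) = 0 := by omega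
    have e2 : p + 3 + 1 - p = 4 := by omega
    rw [e1, e2, Finset.range_eq_Ico]
  rw [hIoo]
  omega

/-- `Φ(p,3)·C(p+3,3) = 2^{p+3} − 2·Σ_{u<4} C(p+3,u)` in `ℚ`, for `p ≥ 4`. -/
theorem phiK_three_mul_choose_eq (p : ℕ) (hp : 4 ≤ p) :
    phiK p 3 * (Nat.choose (p + 3) 3 : ℚ)
      = (2 : ℚ) ^ (p + 3) - 2 * ∑ u ∈ range 4, (Nat.choose (p + 3) u : ℚ) := by
  rw [phiK_three_mul_choose]
  have h := sum_Ioo_choose_add p hp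
  have h' : ((∑ u ∈ Ioo 3 p, Nat.choose (p + 3) u : ℕ) : ℚ) + 2 * ((∑ u ∈ range 4, Nat.choose (p + 3) u : ℕ) : ℚ)
      = (2 : ℚ) ^ (p + 3) := by exact_mod_cast h
  push_cast at h'
  linarith

/-- **A kernel-evaluated cell is a regime-A cell.** -/
theorem regimeA_of_cellOK (p d : ℕ) (hp : 4 ≤ p) (h : cellOK p d = true) : RegimeA p d := by
  unfold cellOK at h
  simp only [chooseF_eq] at h
  have h' := of_decide_eq_true h
  -- the `ℕ` inequality, with the subtraction resolved
  have hsub : 2 * ∑ u ∈ range 4, Nat.choose (p + 3) u ≤ 2 ^ (p + 3) := by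
    have := sum_Ioo_choose_add p hp; omega
  set S := ∑ u ∈ range 4, Nat.choose (p + 3) u with hS
  set D := Nat.choose (p + 3) 3 with hD
  set n := p + d with hn
  set C3 := Nat.choose n 3 with hC3
  set S3n := ∑ j ∈ range 4, Nat.choose n j with hS3n
  set T := ∑ j ∈ range (d + 1), Nat.choose n j with hT
  have hq : ((2 ^ (p + 3) - 2 * S : ℕ) : ℚ) * (134 * (C3 : ℚ) + 35 * (n : ℚ) ^ 2)
      + (D : ℚ) * (35 * (S3n : ℚ) + 99 * (C3 : ℚ) + 35 * (n : ℚ) ^ 2 + 35 * (T : ℚ)) ≤ (D : ℚ) * 35 * (2 : ℚ) ^ n := by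
    exact_mod_cast h'
  rw [Nat.cast_sub hsub] at hq
  push_cast at hq
  -- `Φ·D = 2^{p+3} − 2S`
  have hphi : phiK p 3 * (D : ℚ) = (2 : ℚ) ^ (p + 3) - 2 * (S : ℚ) := by
    rw [hD, hS]; push_cast; exact phiK_three_mul_choose_eq p hp
  have hDpos : (0 : ℚ) < (D : ℚ) := by
    rw [hD]; exact_mod_cast Nat.choose_pos (by omega : 3 ≤ p + 3)
  unfold RegimeA lhsU Ubound Rbound rhoCore
  -- everything as an inequality multiplied by `35·D`
  have key : (phiK p 3 * ((2 + 64 / 35) * (Nat.choose (p + d) 3 : ℚ) + ((p + d : ℕ) : ℚ) ^ 2)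
      + ((∑ j ∈ range 4, (Nat.choose (p + d) j : ℚ)) + (1 + 64 / 35) * (Nat.choose (p + d) 3 : ℚ) + ((p + d : ℕ) : ℚ) ^ 2)
      + ∑ j ∈ range (d + 1), (Nat.choose (p + d) j : ℚ)) * (35 * (D : ℚ))
      = (phiK p 3 * (D : ℚ)) * (134 * (C3 : ℚ) + 35 * (n : ℚ) ^ 2)
        + (D : ℚ) * (35 * (S3n : ℚ) + 99 * (C3 : ℚ) + 35 * (n : ℚ) ^ 2 + 35 * (T : ℚ)) := by
    rw [hC3, hS3n, hT, hn]; push_cast; ring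
  rw [hphi] at key
  have h35 : (0 : ℚ) < 35 * (D : ℚ) := by positivity
  have hfin : (phiK p 3 * ((2 + 64 / 35) * (Nat.choose (p + d) 3 : ℚ) + ((p + d : ℕ) : ℚ) ^ 2)
      + ((∑ j ∈ range 4, (Nat.choose (p + d) j : ℚ)) + (1 + 64 / 35) * (Nat.choose (p + d) 3 : ℚ) + ((p + d : ℕ) : ℚ) ^ 2)
      + ∑ j ∈ range (d + 1), (Nat.choose (p + d) j : ℚ)) * (35 * (D : ℚ)) ≤ (2 : ℚ) ^ (p + d) * (35 * (D : ℚ)) := by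
    rw [key]
    have : (2 : ℚ) ^ (p + d) * (35 * (D : ℚ)) = (D : ℚ) * 35 * (2 : ℚ) ^ n := by rw [hn]; ring
    rw [this]
    exact hq
  exact le_of_mul_le_mul_right hfin h35

/-! ### The tables (kernel evaluation) -/

/-- The cells `p = 9` (`8 ≤ d ≤ 29`) and `10 ≤ p ≤ 12` (`7 ≤ d ≤ 3p + 2`). -/
theorem table_9_12 : (∀ d < 30, 8 ≤ d → cellOK 9 d = true) ∧
    (∀ p < 13, 10 ≤ p → ∀ d < 3 * p + 3, 7 ≤ d → cellOK p d = true) := by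
  decide +kernel

/-- The cells `13 ≤ p ≤ 29`, `6 ≤ d ≤ 3p + 2`. -/
theorem table_13_30 : ∀ p < 30, 13 ≤ p → ∀ d < 3 * p + 3, 6 ≤ d → cellOK p d = true := by
  decide +kernel

/-- The cells `30 ≤ p ≤ 38`, `6 ≤ d ≤ 3p + 2`. -/
theorem table_30_39 : ∀ p < 39, 30 ≤ p → ∀ d < 3 * p + 3, 6 ≤ d → cellOK p d = true := by
  decide +kernel

/-- The cells `39 ≤ p ≤ 46`, `6 ≤ d ≤ 3p + 2`. -/
theorem table_39_47 : ∀ p < 47, 39 ≤ p → ∀ d < 3 * p + 3, 6 ≤ d → cellOK p d = true := by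
  decide +kernel

/-- The cells `47 ≤ p ≤ 54`, `6 ≤ d ≤ 3p + 2`. -/
theorem table_47_55 : ∀ p < 55, 47 ≤ p → ∀ d < 3 * p + 3, 6 ≤ d → cellOK p d = true := by
  decide +kernel

/-- The cells `55 ≤ p ≤ 62`, `6 ≤ d ≤ 3p + 2`. -/
theorem table_55_63 : ∀ p < 63, 55 ≤ p → ∀ d < 3 * p + 3, 6 ≤ d → cellOK p d = true := by
  decide +kernel

/-! ### Regime B′ on `9 ≤ p ≤ 62` -/

/-- `5·n² ≤ C(n,3)` for `n ≥ 33`. -/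
theorem choose_three_ge_five_sq (n : ℕ) (hn : 33 ≤ n) : 5 * n ^ 2 ≤ Nat.choose n 3 := by
  obtain ⟨m, rfl⟩ : ∃ m, n = m + 2 := ⟨n - 2, by omega⟩
  have h := six_mul_choose_three m
  have hm : 31 ≤ m := by omega
  nlinarith [h, hm]

/-- For `n = p + d ≥ 35`: `L(p,d) ≤ (141/35)·Φ·C(n,3) + (162/35)·C(n,3)`. -/
theorem lhsU_le_small (p d : ℕ) (hn : 35 ≤ p + d) :
    lhsU p d ≤ (141 / 35) * (phiK p 3 * (Nat.choose (p + d) 3 : ℚ)) + (162 / 35) * (Nat.choose (p + d) 3 : ℚ) := by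
  have hC : (5 * ((p + d : ℕ) : ℚ) ^ 2) ≤ (Nat.choose (p + d) 3 : ℚ) := by
    exact_mod_cast choose_three_ge_five_sq (p + d) (by omega)
  have hC2 : (Nat.choose (p + d) 2 : ℚ) ≤ ((p + d : ℕ) : ℚ) ^ 2 := by
    exact_mod_cast Nat.choose_le_pow (p + d) 2
  have hn1 : (1 : ℚ) ≤ ((p + d : ℕ) : ℚ) := by exact_mod_cast (show 1 ≤ p + d by omega)
  have hsum : (∑ j ∈ range 4, (Nat.choose (p + d) j : ℚ))
      = 1 + ((p + d : ℕ) : ℚ) + (Nat.choose (p + d) 2 : ℚ) + (Nat.choose (p + d) 3 : ℚ) := by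
    simp [Finset.sum_range_succ]
  have hphi := phiK_three_nonneg p
  have hPn : phiK p 3 * ((p + d : ℕ) : ℚ) ^ 2 ≤ phiK p 3 * ((Nat.choose (p + d) 3 : ℚ) / 5) := by
    apply mul_le_mul_of_nonneg_left _ hphi
    linarith
  have expand : lhsU p d = (2 + 64 / 35) * (phiK p 3 * (Nat.choose (p + d) 3 : ℚ))
      + phiK p 3 * ((p + d : ℕ) : ℚ) ^ 2
      + (1 + ((p + d : ℕ) : ℚ) + (Nat.choose (p + d) 2 : ℚ) + (Nat.choose (p + d) 3 : ℚ))
      + (1 + 64 / 35) * (Nat.choose (p + d) 3 : ℚ) + ((p + d : ℕ) : ℚ) ^ 2 := by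
    unfold lhsU Ubound Rbound rhoCore
    rw [hsum]
    ring
  rw [expand]
  nlinarith [hPn, hC, hC2, hn1]

/-- The numeric input of regime B′ on `9 ≤ p ≤ 62`: `141·2^{p+3} + 162·C(p+3,3) ≤ 35·3^{p−4}·C(p+3,3)`. -/
theorem bprime_numeric : ∀ p < 63, 9 ≤ p →
    141 * 2 ^ (p + 3) + 162 * chooseF (p + 3) 3 ≤ 35 * 3 ^ (p - 4) * chooseF (p + 3) 3 := by
  decide +kernel

/-- **Regime B′ for `9 ≤ p ≤ 62`, `d ≥ 3p − 1`.** -/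
theorem regimeB_small (p d : ℕ) (hp : 9 ≤ p) (hp' : p ≤ 62) (hd : 3 * p ≤ d + 1) : RegimeB p d := by
  unfold RegimeB
  have hn : 35 ≤ p + d := by omega
  have hL := lhsU_le_small p d hn
  have hnum := bprime_numeric p (by omega) hp
  rw [chooseF_eq] at hnum
  have hphiD := phiK_three_mul_choose_le p
  have hphi0 := phiK_three_nonneg p
  have hCn : (0 : ℚ) ≤ (Nat.choose (p + d) 3 : ℚ) := by positivity
  have hDpos : (0 : ℚ) < (Nat.choose (p + 3) 3 : ℚ) := by exact_mod_cast Nat.choose_pos (by omega : 3 ≤ p + 3)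
  -- `L·D ≤ C·(141·2^{p+3} + 162·D)/35 ≤ C·3^{p−4}·D`
  obtain ⟨k, rfl⟩ : ∃ k, p = k + 4 := ⟨p - 4, by omega⟩
  have hnumq : (141 : ℚ) * 2 ^ (k + 4 + 3) + 162 * (Nat.choose (k + 4 + 3) 3 : ℚ)
      ≤ 35 * 3 ^ k * (Nat.choose (k + 4 + 3) 3 : ℚ) := by
    have := hnum
    rw [show k + 4 - 4 = k by omega] at this
    exact_mod_cast this
  set D : ℚ := (Nat.choose (k + 4 + 3) 3 : ℚ) with hD
  set C : ℚ := (Nat.choose (k + 4 + d) 3 : ℚ) with hC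
  set PC : ℚ := phiK (k + 4) 3 * C with hPC
  have h1 : PC * D ≤ 2 ^ (k + 4 + 3) * C := by
    calc PC * D = (phiK (k + 4) 3 * D) * C := by rw [hPC]; ring
      _ ≤ 2 ^ (k + 4 + 3) * C := mul_le_mul_of_nonneg_right hphiD hCn
  have hLD : lhsU (k + 4) d * D ≤ 3 ^ k * C * D := by
    have h2 : lhsU (k + 4) d * D ≤ ((141 / 35) * PC + (162 / 35) * C) * D :=
      mul_le_mul_of_nonneg_right hL hDpos.le
    have h3 : ((141 / 35) * PC + (162 / 35) * C) * D = (141 / 35) * (PC * D) + (162 / 35) * C * D := by ring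
    have h4 : (141 / 35) * (PC * D) + (162 / 35) * C * D ≤ (141 / 35) * (2 ^ (k + 4 + 3) * C) + (162 / 35) * C * D := by
      nlinarith [h1]
    have h5 : (141 / 35) * (2 ^ (k + 4 + 3) * C) + (162 / 35) * C * D = C * ((141 * 2 ^ (k + 4 + 3) + 162 * D) / 35) := by ring
    have h6 : C * ((141 * 2 ^ (k + 4 + 3) + 162 * D) / 35) ≤ C * (3 ^ k * D) := by
      apply mul_le_mul_of_nonneg_left _ hCn
      rw [div_le_iff₀ (by norm_num : (0 : ℚ) < 35)]
      linarith [hnumq]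
    calc lhsU (k + 4) d * D ≤ _ := h2
      _ = _ := h3
      _ ≤ _ := h4
      _ = _ := h5
      _ ≤ C * (3 ^ k * D) := h6
      _ = 3 ^ k * C * D := by ring
  have hL' : lhsU (k + 4) d ≤ 3 ^ k * C := le_of_mul_le_mul_right hLD hDpos
  have hgrow : (3 : ℚ) ^ k * (Nat.choose (k + 4 + d) 3 : ℚ) ≤ (Nat.choose (k + 4 + d) (k + 3) : ℚ) := by
    exact_mod_cast three_pow_mul_choose_three_le (k + 4 + d) (k + 4) (by omega) k (le_refl _)
  have hsingle : (Nat.choose (k + 4 + d) (k + 3) : ℚ)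
      ≤ ∑ u ∈ Ico 4 (k + 4), (Nat.choose (k + 4 + d) u : ℚ) := by
    apply single_le_sum (f := fun u => (Nat.choose (k + 4 + d) u : ℚ)) (fun _ _ => by positivity)
    simp only [mem_Ico]
    omega
  calc lhsU (k + 4) d ≤ 3 ^ k * C := hL'
    _ ≤ (Nat.choose (k + 4 + d) (k + 3) : ℚ) := hgrow
    _ ≤ _ := hsingle

/-! ### The combined statements -/

/-- The lower end of regime A per `p`: `8` at `p = 9`, `7` at `10 ≤ p ≤ 12`, `6` from `p = 13`. -/
def amin (p : ℕ) : ℕ := if p ≤ 9 then 8 else if p ≤ 12 then 7 else 6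

/-- **THEOREM R3 on `9 ≤ p ≤ 62`**: regime A or B′ on every cell `amin p ≤ d`. -/
theorem regime_small (p d : ℕ) (hp : 9 ≤ p) (hp' : p ≤ 62) (hd : amin p ≤ d) : RegimeA p d ∨ RegimeB p d := by
  rcases Nat.lt_or_ge d (3 * p + 3) with hlt | hge
  · left
    apply regimeA_of_cellOK p d (by omega)
    unfold amin at hd
    rcases Nat.lt_or_ge p 13 with h13 | h13
    · rcases Nat.lt_or_ge p 10 with h10 | h10
      · have : p = 9 := by omega
        subst this
        exact table_9_12.1 d (by omega) (by simp at hd; omega)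
      · exact table_9_12.2 p h13 h10 d hlt (by simp [show ¬ p ≤ 9 by omega, show p ≤ 12 by omega] at hd; omega)
    · have hd6 : 6 ≤ d := by simp [show ¬ p ≤ 9 by omega, show ¬ p ≤ 12 by omega] at hd; omega
      rcases Nat.lt_or_ge p 30 with h30 | h30
      · exact table_13_30 p h30 h13 d hlt hd6
      · rcases Nat.lt_or_ge p 39 with h39 | h39
        · exact table_30_39 p h39 h30 d hlt hd6
        · rcases Nat.lt_or_ge p 47 with h47 | h47
          · exact table_39_47 p h47 h39 d hlt hd6
          · rcases Nat.lt_or_ge p 55 with h55 | h55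
            · exact table_47_55 p h55 h47 d hlt hd6
            · exact table_55_63 p (by omega) h55 d hlt hd6
  · right
    exact regimeB_small p d hp hp' (by omega)

/-- **THEOREM R3 for every `p ≥ 13` and every `d ≥ 6`** (the cells to `p = 62`, `CoreRegimesLow` beyond). -/
theorem regime_of_six_le_all (p d : ℕ) (hp : 13 ≤ p) (hd : 6 ≤ d) : RegimeA p d ∨ RegimeB p d := by
  rcases Nat.lt_or_ge p 63 with h | h
  · exact regime_small p d (by omega) (by omega) (by unfold amin; simp [show ¬ p ≤ 9 by omega, show ¬ p ≤ 12 by omega]; exact hd)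
  · exact regime_of_six_le_low p d h hd

/-- **THEOREM R3 for every `p ≥ 9` and every `d ≥ amin p`.** -/
theorem regime_of_amin (p d : ℕ) (hp : 9 ≤ p) (hd : amin p ≤ d) : RegimeA p d ∨ RegimeB p d := by
  rcases Nat.lt_or_ge p 63 with h | h
  · exact regime_small p d hp (by omega) hd
  · have hd6 : 6 ≤ d := by unfold amin at hd; simp [show ¬ p ≤ 9 by omega, show ¬ p ≤ 12 by omega] at hd; exact hd
    exact regime_of_six_le_low p d h hd6

end CoreRegimes
end PercRepro
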